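import Summits.Ventures.PercRepro.C026BadBridge

/-!
# The three forms of ROW C-041 `(G⅔)` (p6, gen 20)

Setting of `C026GoodDegreeBridge` / `C026BadBridge`: `(D,A)` sources, `Good_t`, `Bad`;
`GG := Good_a ∩ Good_b`, `SG := (Good_a ∪ Good_b) ∖ GG` (exactly one of the two).  ROW C-041 is stated
by its owner in three equivalent ways (CONJECTURES.md v347; MINE3-GLUING §40):

  `2·n(D,A) ≤ 3·(#Good_a + #Good_b)`  ⟺  `2·#Bad ≤ 4·#GG + #SG`  ⟺  `#Bad_a + #Bad_b ≤ 2·(#Good_a + #Good_b)`,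

the middle one being the count that mine-3's cluster-cube certificate system (CC) targets (every Bad
source paid 2 units by the Good sources of its cluster cube, capacities GG 4 / SG 1).  This file proves
the identities `n(D,A) = #Bad + #GG + #SG` and `#Good_a + #Good_b = 2·#GG + #SG`
(`card_DA_eq_bad_add_GG_add_SG`, `card_goodA_add_goodB_eq`), the equivalence of the first two forms
(`goodDegree_iff_bad_le_GG_SG`), and the bridge from the (CC) count to THEOREM L2
(`pFun_threeCells_nonneg_of_bad_le_GG_SG`): a kernel-checked (CC) count closes the two-live-vertex
case of CONJECTURE (P) on the skeleton.
-/

namespace PercRepro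

namespace MultiGraph

open Finset

variable {V E : Type*} {G : MultiGraph V E} [Fintype V] [DecidableEq V] [Fintype E] [DecidableEq E]

omit [Fintype V] [DecidableEq V] in
open Classical in
/-- `n(D,A) = #Bad + #GG + #SG`. -/
theorem card_DA_eq_bad_add_GG_add_SG (a b c : V) :
    (univ.filter fun S : Config E => (G.Conn S c a ∧ G.Conn S c b) ∧
        (¬ G.Conn Sᶜ c a ∧ ¬ G.Conn Sᶜ c b ∧ ¬ G.Conn Sᶜ a b)).card =
      (univ.filter fun S : Config E => ((G.Conn S c a ∧ G.Conn S c b) ∧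
        (¬ G.Conn Sᶜ c a ∧ ¬ G.Conn Sᶜ c b ∧ ¬ G.Conn Sᶜ a b)) ∧
        ¬ (G.WalkAvoiding S (G.cluster Sᶜ a) c b ∨ G.WalkAvoiding S (G.cluster Sᶜ b) c a)).card +
      (univ.filter fun S : Config E => ((G.Conn S c a ∧ G.Conn S c b) ∧
        (¬ G.Conn Sᶜ c a ∧ ¬ G.Conn Sᶜ c b ∧ ¬ G.Conn Sᶜ a b)) ∧
        (G.WalkAvoiding S (G.cluster Sᶜ a) c b ∧ G.WalkAvoiding S (G.cluster Sᶜ b) c a)).card +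
      (univ.filter fun S : Config E => ((G.Conn S c a ∧ G.Conn S c b) ∧
        (¬ G.Conn Sᶜ c a ∧ ¬ G.Conn Sᶜ c b ∧ ¬ G.Conn Sᶜ a b)) ∧
        ((G.WalkAvoiding S (G.cluster Sᶜ a) c b ∧ ¬ G.WalkAvoiding S (G.cluster Sᶜ b) c a) ∨
          (G.WalkAvoiding S (G.cluster Sᶜ b) c a ∧ ¬ G.WalkAvoiding S (G.cluster Sᶜ a) c b))).card := by
  rw [card_DA_eq_good_add_bad]
  -- split `Good = Good_a ∪ Good_b` into `GG` and `SG`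
  have hsplit := Finset.card_filter_add_card_filter_not
    (s := univ.filter fun S : Config E => ((G.Conn S c a ∧ G.Conn S c b) ∧
      (¬ G.Conn Sᶜ c a ∧ ¬ G.Conn Sᶜ c b ∧ ¬ G.Conn Sᶜ a b)) ∧
      (G.WalkAvoiding S (G.cluster Sᶜ a) c b ∨ G.WalkAvoiding S (G.cluster Sᶜ b) c a))
    (fun S : Config E => G.WalkAvoiding S (G.cluster Sᶜ a) c b ∧
      G.WalkAvoiding S (G.cluster Sᶜ b) c a)
  rw [Finset.filter_filter, Finset.filter_filter] at hsplit
  have h1 : (univ.filter fun S : Config E => (((G.Conn S c a ∧ G.Conn S c b) ∧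
        (¬ G.Conn Sᶜ c a ∧ ¬ G.Conn Sᶜ c b ∧ ¬ G.Conn Sᶜ a b)) ∧
        (G.WalkAvoiding S (G.cluster Sᶜ a) c b ∨ G.WalkAvoiding S (G.cluster Sᶜ b) c a)) ∧
        (G.WalkAvoiding S (G.cluster Sᶜ a) c b ∧ G.WalkAvoiding S (G.cluster Sᶜ b) c a)).card =
      (univ.filter fun S : Config E => ((G.Conn S c a ∧ G.Conn S c b) ∧
        (¬ G.Conn Sᶜ c a ∧ ¬ G.Conn Sᶜ c b ∧ ¬ G.Conn Sᶜ a b)) ∧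
        (G.WalkAvoiding S (G.cluster Sᶜ a) c b ∧ G.WalkAvoiding S (G.cluster Sᶜ b) c a)).card := by
    congr 1
    apply Finset.filter_congr
    intro S _
    constructor
    · rintro ⟨⟨hDA, _⟩, hGG⟩
      exact ⟨hDA, hGG⟩
    · rintro ⟨hDA, hGG⟩
      exact ⟨⟨hDA, Or.inl hGG.1⟩, hGG⟩
  have h2 : (univ.filter fun S : Config E => (((G.Conn S c a ∧ G.Conn S c b) ∧
        (¬ G.Conn Sᶜ c a ∧ ¬ G.Conn Sᶜ c b ∧ ¬ G.Conn Sᶜ a b)) ∧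
        (G.WalkAvoiding S (G.cluster Sᶜ a) c b ∨ G.WalkAvoiding S (G.cluster Sᶜ b) c a)) ∧
        ¬ (G.WalkAvoiding S (G.cluster Sᶜ a) c b ∧ G.WalkAvoiding S (G.cluster Sᶜ b) c a)).card =
      (univ.filter fun S : Config E => ((G.Conn S c a ∧ G.Conn S c b) ∧
        (¬ G.Conn Sᶜ c a ∧ ¬ G.Conn Sᶜ c b ∧ ¬ G.Conn Sᶜ a b)) ∧
        ((G.WalkAvoiding S (G.cluster Sᶜ a) c b ∧ ¬ G.WalkAvoiding S (G.cluster Sᶜ b) c a) ∨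
          (G.WalkAvoiding S (G.cluster Sᶜ b) c a ∧ ¬ G.WalkAvoiding S (G.cluster Sᶜ a) c b))).card := by
    congr 1
    apply Finset.filter_congr
    intro S _
    constructor
    · rintro ⟨⟨hDA, hor⟩, hnot⟩
      refine ⟨hDA, ?_⟩
      rcases hor with h | h
      · exact Or.inl ⟨h, fun h' => hnot ⟨h, h'⟩⟩
      · exact Or.inr ⟨h, fun h' => hnot ⟨h', h⟩⟩
    · rintro ⟨hDA, hor⟩
      rcases hor with ⟨h, h'⟩ | ⟨h, h'⟩
      · exact ⟨⟨hDA, Or.inl h⟩, fun hGG => h' hGG.2⟩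
      · exact ⟨⟨hDA, Or.inr h⟩, fun hGG => h' hGG.1⟩
  omega

omit [Fintype V] [DecidableEq V] in
open Classical in
/-- `#Good_a + #Good_b = 2·#GG + #SG`. -/
theorem card_goodA_add_goodB_eq (a b c : V) :
    (univ.filter fun S : Config E => ((G.Conn S c a ∧ G.Conn S c b) ∧
        (¬ G.Conn Sᶜ c a ∧ ¬ G.Conn Sᶜ c b ∧ ¬ G.Conn Sᶜ a b)) ∧
        G.WalkAvoiding S (G.cluster Sᶜ a) c b).card +
      (univ.filter fun S : Config E => ((G.Conn S c a ∧ G.Conn S c b) ∧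
        (¬ G.Conn Sᶜ c a ∧ ¬ G.Conn Sᶜ c b ∧ ¬ G.Conn Sᶜ a b)) ∧
        G.WalkAvoiding S (G.cluster Sᶜ b) c a).card =
      2 * (univ.filter fun S : Config E => ((G.Conn S c a ∧ G.Conn S c b) ∧
        (¬ G.Conn Sᶜ c a ∧ ¬ G.Conn Sᶜ c b ∧ ¬ G.Conn Sᶜ a b)) ∧
        (G.WalkAvoiding S (G.cluster Sᶜ a) c b ∧ G.WalkAvoiding S (G.cluster Sᶜ b) c a)).card +
      (univ.filter fun S : Config E => ((G.Conn S c a ∧ G.Conn S c b) ∧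
        (¬ G.Conn Sᶜ c a ∧ ¬ G.Conn Sᶜ c b ∧ ¬ G.Conn Sᶜ a b)) ∧
        ((G.WalkAvoiding S (G.cluster Sᶜ a) c b ∧ ¬ G.WalkAvoiding S (G.cluster Sᶜ b) c a) ∨
          (G.WalkAvoiding S (G.cluster Sᶜ b) c a ∧ ¬ G.WalkAvoiding S (G.cluster Sᶜ a) c b))).card := by
  -- `Good_a = GG ⊔ (Good_a ∖ Good_b)`, `Good_b = GG ⊔ (Good_b ∖ Good_a)`, `SG = (Good_a ∖ Good_b) ⊔ (Good_b ∖ Good_a)`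
  have ha := Finset.card_filter_add_card_filter_not
    (s := univ.filter fun S : Config E => ((G.Conn S c a ∧ G.Conn S c b) ∧
      (¬ G.Conn Sᶜ c a ∧ ¬ G.Conn Sᶜ c b ∧ ¬ G.Conn Sᶜ a b)) ∧ G.WalkAvoiding S (G.cluster Sᶜ a) c b)
    (fun S : Config E => G.WalkAvoiding S (G.cluster Sᶜ b) c a)
  have hb := Finset.card_filter_add_card_filter_not
    (s := univ.filter fun S : Config E => ((G.Conn S c a ∧ G.Conn S c b) ∧
      (¬ G.Conn Sᶜ c a ∧ ¬ G.Conn Sᶜ c b ∧ ¬ G.Conn Sᶜ a b)) ∧ G.WalkAvoiding S (G.cluster Sᶜ b) c a)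
    (fun S : Config E => G.WalkAvoiding S (G.cluster Sᶜ a) c b)
  rw [Finset.filter_filter, Finset.filter_filter] at ha hb
  have hSG : (univ.filter fun S : Config E => ((G.Conn S c a ∧ G.Conn S c b) ∧
        (¬ G.Conn Sᶜ c a ∧ ¬ G.Conn Sᶜ c b ∧ ¬ G.Conn Sᶜ a b)) ∧
        ((G.WalkAvoiding S (G.cluster Sᶜ a) c b ∧ ¬ G.WalkAvoiding S (G.cluster Sᶜ b) c a) ∨
          (G.WalkAvoiding S (G.cluster Sᶜ b) c a ∧ ¬ G.WalkAvoiding S (G.cluster Sᶜ a) c b))).card =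
      (univ.filter fun S : Config E => (((G.Conn S c a ∧ G.Conn S c b) ∧
        (¬ G.Conn Sᶜ c a ∧ ¬ G.Conn Sᶜ c b ∧ ¬ G.Conn Sᶜ a b)) ∧ G.WalkAvoiding S (G.cluster Sᶜ a) c b) ∧
        ¬ G.WalkAvoiding S (G.cluster Sᶜ b) c a).card +
      (univ.filter fun S : Config E => (((G.Conn S c a ∧ G.Conn S c b) ∧
        (¬ G.Conn Sᶜ c a ∧ ¬ G.Conn Sᶜ c b ∧ ¬ G.Conn Sᶜ a b)) ∧ G.WalkAvoiding S (G.cluster Sᶜ b) c a) ∧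
        ¬ G.WalkAvoiding S (G.cluster Sᶜ a) c b).card := by
    rw [← Finset.card_union_of_disjoint]
    · congr 1
      ext S
      simp only [mem_filter, mem_univ, true_and, mem_union]
      constructor
      · rintro ⟨hDA, h⟩
        rcases h with ⟨h1, h2⟩ | ⟨h1, h2⟩
        · exact Or.inl ⟨⟨hDA, h1⟩, h2⟩
        · exact Or.inr ⟨⟨hDA, h1⟩, h2⟩
      · rintro (⟨⟨hDA, h1⟩, h2⟩ | ⟨⟨hDA, h1⟩, h2⟩)
        · exact ⟨hDA, Or.inl ⟨h1, h2⟩⟩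
        · exact ⟨hDA, Or.inr ⟨h1, h2⟩⟩
    · rw [Finset.disjoint_filter]
      rintro S _ ⟨⟨_, h1⟩, _⟩ ⟨_, h2⟩
      exact h2 h1
  have hGG : (univ.filter fun S : Config E => (((G.Conn S c a ∧ G.Conn S c b) ∧
        (¬ G.Conn Sᶜ c a ∧ ¬ G.Conn Sᶜ c b ∧ ¬ G.Conn Sᶜ a b)) ∧ G.WalkAvoiding S (G.cluster Sᶜ b) c a) ∧
        G.WalkAvoiding S (G.cluster Sᶜ a) c b).card =
      (univ.filter fun S : Config E => (((G.Conn S c a ∧ G.Conn S c b) ∧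
        (¬ G.Conn Sᶜ c a ∧ ¬ G.Conn Sᶜ c b ∧ ¬ G.Conn Sᶜ a b)) ∧ G.WalkAvoiding S (G.cluster Sᶜ a) c b) ∧
        G.WalkAvoiding S (G.cluster Sᶜ b) c a).card := by
    congr 1
    apply Finset.filter_congr
    intro S _
    constructor
    · rintro ⟨⟨hDA, h1⟩, h2⟩
      exact ⟨⟨hDA, h2⟩, h1⟩
    · rintro ⟨⟨hDA, h1⟩, h2⟩
      exact ⟨⟨hDA, h2⟩, h1⟩
  have hGG' : (univ.filter fun S : Config E => (((G.Conn S c a ∧ G.Conn S c b) ∧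
        (¬ G.Conn Sᶜ c a ∧ ¬ G.Conn Sᶜ c b ∧ ¬ G.Conn Sᶜ a b)) ∧ G.WalkAvoiding S (G.cluster Sᶜ a) c b) ∧
        G.WalkAvoiding S (G.cluster Sᶜ b) c a).card =
      (univ.filter fun S : Config E => ((G.Conn S c a ∧ G.Conn S c b) ∧
        (¬ G.Conn Sᶜ c a ∧ ¬ G.Conn Sᶜ c b ∧ ¬ G.Conn Sᶜ a b)) ∧
        (G.WalkAvoiding S (G.cluster Sᶜ a) c b ∧ G.WalkAvoiding S (G.cluster Sᶜ b) c a)).card := by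
    congr 1
    apply Finset.filter_congr
    intro S _
    exact and_assoc
  omega

omit [Fintype V] [DecidableEq V] in
open Classical in
/-- **The two forms of `(G⅔)` are the same count**: `2·n(D,A) ≤ 3·(#Good_a + #Good_b)` iff
`2·#Bad ≤ 4·#GG + #SG` (the (CC) count). -/
theorem goodDegree_iff_bad_le_GG_SG (a b c : V) :
    (2 * (univ.filter fun S : Config E => (G.Conn S c a ∧ G.Conn S c b) ∧
          (¬ G.Conn Sᶜ c a ∧ ¬ G.Conn Sᶜ c b ∧ ¬ G.Conn Sᶜ a b)).card ≤
        3 * ((univ.filter fun S : Config E => ((G.Conn S c a ∧ G.Conn S c b) ∧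
            (¬ G.Conn Sᶜ c a ∧ ¬ G.Conn Sᶜ c b ∧ ¬ G.Conn Sᶜ a b)) ∧
            G.WalkAvoiding S (G.cluster Sᶜ a) c b).card +
          (univ.filter fun S : Config E => ((G.Conn S c a ∧ G.Conn S c b) ∧
            (¬ G.Conn Sᶜ c a ∧ ¬ G.Conn Sᶜ c b ∧ ¬ G.Conn Sᶜ a b)) ∧
            G.WalkAvoiding S (G.cluster Sᶜ b) c a).card)) ↔
      (2 * (univ.filter fun S : Config E => ((G.Conn S c a ∧ G.Conn S c b) ∧
          (¬ G.Conn Sᶜ c a ∧ ¬ G.Conn Sᶜ c b ∧ ¬ G.Conn Sᶜ a b)) ∧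
          ¬ (G.WalkAvoiding S (G.cluster Sᶜ a) c b ∨
            G.WalkAvoiding S (G.cluster Sᶜ b) c a)).card ≤
        4 * (univ.filter fun S : Config E => ((G.Conn S c a ∧ G.Conn S c b) ∧
          (¬ G.Conn Sᶜ c a ∧ ¬ G.Conn Sᶜ c b ∧ ¬ G.Conn Sᶜ a b)) ∧
          (G.WalkAvoiding S (G.cluster Sᶜ a) c b ∧ G.WalkAvoiding S (G.cluster Sᶜ b) c a)).card +
        (univ.filter fun S : Config E => ((G.Conn S c a ∧ G.Conn S c b) ∧
          (¬ G.Conn Sᶜ c a ∧ ¬ G.Conn Sᶜ c b ∧ ¬ G.Conn Sᶜ a b)) ∧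
          ((G.WalkAvoiding S (G.cluster Sᶜ a) c b ∧ ¬ G.WalkAvoiding S (G.cluster Sᶜ b) c a) ∨
            (G.WalkAvoiding S (G.cluster Sᶜ b) c a ∧
              ¬ G.WalkAvoiding S (G.cluster Sᶜ a) c b))).card) := by
  have h1 := card_DA_eq_bad_add_GG_add_SG (G := G) a b c
  have h2 := card_goodA_add_goodB_eq (G := G) a b c
  omega

open Classical in
/-- **The (CC) count ⟹ THEOREM L2 (live probe)**: `2·#Bad ≤ 4·#GG + #SG` on the skeleton gives
`(P) ≥ 0` at every band state of the probe and of the two live vertices. -/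
theorem pFun_threeCells_nonneg_of_bad_le_GG_SG (a b c : V)
    (hCC : 2 * (univ.filter fun S : Config E => ((G.Conn S c a ∧ G.Conn S c b) ∧
          (¬ G.Conn Sᶜ c a ∧ ¬ G.Conn Sᶜ c b ∧ ¬ G.Conn Sᶜ a b)) ∧
          ¬ (G.WalkAvoiding S (G.cluster Sᶜ a) c b ∨
            G.WalkAvoiding S (G.cluster Sᶜ b) c a)).card ≤
        4 * (univ.filter fun S : Config E => ((G.Conn S c a ∧ G.Conn S c b) ∧
          (¬ G.Conn Sᶜ c a ∧ ¬ G.Conn Sᶜ c b ∧ ¬ G.Conn Sᶜ a b)) ∧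
          (G.WalkAvoiding S (G.cluster Sᶜ a) c b ∧ G.WalkAvoiding S (G.cluster Sᶜ b) c a)).card +
        (univ.filter fun S : Config E => ((G.Conn S c a ∧ G.Conn S c b) ∧
          (¬ G.Conn Sᶜ c a ∧ ¬ G.Conn Sᶜ c b ∧ ¬ G.Conn Sᶜ a b)) ∧
          ((G.WalkAvoiding S (G.cluster Sᶜ a) c b ∧ ¬ G.WalkAvoiding S (G.cluster Sᶜ b) c a) ∨
            (G.WalkAvoiding S (G.cluster Sᶜ b) c a ∧
              ¬ G.WalkAvoiding S (G.cluster Sᶜ a) c b))).card)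
    {z κ x₁ K₁ x₂ K₂ : ℝ}
    (hz : 0 ≤ z ∧ z ≤ 1) (hκ : kMin z ≤ κ) (hx₁ : 0 ≤ x₁ ∧ x₁ ≤ 1) (hx₂ : 0 ≤ x₂ ∧ x₂ ≤ 1)
    (hK₁ : kMin x₁ ≤ K₁) (hK₂ : kMin x₂ ≤ K₂) :
    0 ≤ G.pFun c (threeCells c a b z x₁ x₂) (threeCells c a b κ K₁ K₂) univ :=
  pFun_threeCells_nonneg_of_goodDegree a b c ((goodDegree_iff_bad_le_GG_SG a b c).2 hCC)
    hz hκ hx₁ hx₂ hK₁ hK₂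

end MultiGraph

end PercRepro
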